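import Literature.Analysis.FluidPDE.CollisionalTransfer
import Literature.Analysis.FluidPDE.HardSphereCollisionRecord
import Literature.Analysis.FluidPDE.HardSphereDynamicsProofs
import Literature.MathematicalPhysics.KineticTheory.HardSphereTwoTimePressure
import Literature.MathematicalPhysics.KineticTheory.HardSphereEulerProofs
import HarnessLib

/-!
# The window gain ceiling from the energy-weighted flux ceiling (stub S2b of the line
# `quartic-schur-ledger`, crux `EnergyCurrentTails`, stmt-AtomisticToContinuum-9235)

Stub worker file for the registered stub `stub_gainCeiling_of_energyFluxCeiling` of the line
lead's skeleton `Cruxes/EnergyCurrentTails/Lines/quartic-schur-ledger.lean` (primary crux decl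
`Summit.AtomisticToContinuum.HydrodynamicLimit.Theses.WarmColdDichotomy.EnergyCurrentTails`, route
copy `…Theses.OneFlightGossipEngine.EnergyCurrentTails`).  The statement only mentions the
Literature prelude (`T3`, `V3`, `hsDiameter`, `localGibbsLaw`, `IsHardSphereEulerSolution`,
`TendstoHydroFieldsAt`, `HardSphereFlow.collisionSum`), so no `Summits` module is imported.

**Statement (`Q0 → S2a → S2`).**  Write `λ_N = localGibbsLaw σ a₀ u₀ θ₀ N (Φ N)`,
`m_k(r) = ∫ (N+1)⁻¹ ∑ᵢ ‖vᵢ(r)‖ᵏ dλ_N` (`vᵢ(r) = ((Φ N).flow r z i).2`, an `ℝ≥0∞`), and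
`Gain(s,s′] = ∫ (N+1)⁻¹ Σ_{ordered collision records in (s,s′]} (Δ₄)₊/2 dλ_N`,
`Δ₄ = ‖v₁⁺‖⁴ + ‖v₂⁺‖⁴ − ‖v₁⁻‖⁴ − ‖v₂⁻‖⁴`.  ASSUMING the datum bound Q0 (`m₄(0) ≤ B` for `N ≥ N₀`)
and the energy-weighted pre-collisional flux ceiling S2a
(`∫ (N+1)⁻¹ Σ_{records in (s,s′]} ‖v₁⁻‖²‖v₂⁻‖² dλ_N ≤ K σ²(N+1)^{1/3}(s′−s) · sup m₂ · sup m₃` on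
windows `s′ ≤ s + τ(N+1)^{-1/3}`), the sub-linear gain ceiling S2 follows: for every slope `η > 0`
there is `D ≥ 0` with `Gain(s,s′] ≤ D + η · sup_{r ∈ [s,s′]} m₄(r)` on the same windows.

**Proof (bookkeeping only).**  (1) Per record, pair energy conservation
(`HardSphereCollisionRecord.ofConfig_norm_sq_preVel`) gives `(Δ₄)₊/2 ≤ ‖v₁⁻‖²‖v₂⁻‖²`
(`quarticGain_le_normSq_mul`), so pathwise on the good set the gain sum is at most the flux sum
(`collisionPairSum_mono`), and `Gain ≤` the flux functional of S2a (`lintegral_mono_ae` over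
`ae_mem_good_localGibbsLaw`).  (2) Energy conservation on the good set
(`IsHardSphereTrajectory.configEnergy_eq_holds`) and `‖v‖² ≤ 1 + ‖v‖⁴` give `m₂(r) ≤ 1 + m₄(0) ≤ 1 + B`
(probability measure for `σ ≤ 1/2`).  (3) Pointwise AM–GM `a³ ≤ (λa⁴ + a²/λ)/2` gives
`m₃(r) ≤ (λ/2) m₄(r) + m₂(r)/(2λ)`.  (4) The clock cancels: `(N+1)^{1/3}(s′−s) ≤ τ`.  (5) With
`M = 1 + B`, `K′ = K + 1`, `λ = 2η/(K′σ²τM)` the slope is `η` and `D = (K′σ²τ)²M³/(4η)`; all of it in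
`ℝ≥0∞` with `ofReal` coefficients (the supremum `sup m₄` may be `⊤`).

References: Cercignani–Illner–Pulvirenti 1994 §4.2 (elastic collisions); Bobylev 1997 /
Mischler–Wennberg 1999 (Povzner-type quartic bookkeeping).
-/

noncomputable section

open MeasureTheory Set Filter
open scoped ENNReal

namespace Summit.AtomisticToContinuum.HydrodynamicLimit.Theorems.QuarticSchurLedger

open Literature.MathematicalPhysics.KineticTheory Literature.Analysis.FluidPDE

/-! ### Elementary real inequalities -/

/-- **Per-collision gain bound by the bilinear pre-collisional mark.**  If the pair energy is
conserved, `y₁² + y₂² = x₁² + x₂²` (`x` = post-, `y` = pre-collisional speeds), then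
`(x₁⁴ + x₂⁴ − y₁⁴ − y₂⁴)₊/2 ≤ y₁² y₂²` (`x₁⁴ + x₂⁴ ≤ (x₁² + x₂²)² = (y₁² + y₂²)²`). [folklore] -/
theorem quarticGain_le_normSq_mul {x₁ x₂ y₁ y₂ : ℝ} (h : y₁ ^ 2 + y₂ ^ 2 = x₁ ^ 2 + x₂ ^ 2) :
    max (x₁ ^ 4 + x₂ ^ 4 - y₁ ^ 4 - y₂ ^ 4) 0 / 2 ≤ y₁ ^ 2 * y₂ ^ 2 := by
  have h' : (y₁ ^ 2 + y₂ ^ 2) ^ 2 = (x₁ ^ 2 + x₂ ^ 2) ^ 2 := by rw [h]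
  have h1 : x₁ ^ 4 + x₂ ^ 4 - y₁ ^ 4 - y₂ ^ 4 ≤ 2 * (y₁ ^ 2 * y₂ ^ 2) := by
    nlinarith [mul_nonneg (sq_nonneg x₁) (sq_nonneg x₂)]
  have h2 : (0 : ℝ) ≤ 2 * (y₁ ^ 2 * y₂ ^ 2) := by positivity
  linarith [max_le h1 h2]

/-- `a² ≤ 1 + a⁴` (`(a² − 1)² ≥ 0`). [folklore] -/
theorem sq_le_one_add_pow_four (a : ℝ) : a ^ 2 ≤ 1 + a ^ 4 := by
  nlinarith [sq_nonneg (a ^ 2 - 1), sq_nonneg a]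

/-- **Pointwise AM–GM for the cube**: `a³ ≤ (λ/2) a⁴ + a²/(2λ)` for `λ > 0`
(`(λa² − a)² ≥ 0`). [folklore] -/
theorem pow_three_le_quartic_add_sq (a : ℝ) {l : ℝ} (hl : 0 < l) :
    a ^ 3 ≤ l / 2 * a ^ 4 + 1 / (2 * l) * a ^ 2 := by
  have h2l : 0 < 2 * l := by positivity
  have heq : l / 2 * a ^ 4 + 1 / (2 * l) * a ^ 2 = (l ^ 2 * a ^ 4 + a ^ 2) / (2 * l) := by
    field_simp
  rw [heq, le_div_iff₀ h2l]
  nlinarith [sq_nonneg (l * a ^ 2 - a)]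

/-- The AM–GM bound summed and normalised: `c Σ fᵢ³ ≤ (λ/2)(c Σ fᵢ⁴) + (c Σ fᵢ²)/(2λ)` for `c ≥ 0`,
`λ > 0`. [folklore] -/
theorem cubicAvg_le_quartic_add_sq {ι : Type*} (s : Finset ι) (f : ι → ℝ) {c l : ℝ} (hc : 0 ≤ c)
    (hl : 0 < l) :
    c * ∑ i ∈ s, f i ^ 3 ≤ l / 2 * (c * ∑ i ∈ s, f i ^ 4) + 1 / (2 * l) * (c * ∑ i ∈ s, f i ^ 2) := by
  have h : ∑ i ∈ s, f i ^ 3 ≤ ∑ i ∈ s, (l / 2 * f i ^ 4 + 1 / (2 * l) * f i ^ 2) :=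
    Finset.sum_le_sum fun i _ => pow_three_le_quartic_add_sq (f i) hl
  rw [Finset.sum_add_distrib, ← Finset.mul_sum, ← Finset.mul_sum] at h
  calc c * ∑ i ∈ s, f i ^ 3 ≤ c * (l / 2 * ∑ i ∈ s, f i ^ 4 + 1 / (2 * l) * ∑ i ∈ s, f i ^ 2) :=
        mul_le_mul_of_nonneg_left h hc
    _ = _ := by ring

/-- **The collision clock cancels over one window**: for `s′ ≤ s + τ x^{-1/3}` (`x = N + 1 > 0`),
`K · (σ² x^{1/3} (s′ − s)) ≤ (K + 1) σ² τ`. [folklore] -/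
theorem clockFactor_le {K σ τ x s s' : ℝ} (hK : 0 ≤ K) (hτ : 0 ≤ τ) (hx : 0 < x)
    (hs' : s' ≤ s + τ * x ^ (-(1 / 3 : ℝ))) :
    K * (σ ^ 2 * x ^ (1 / 3 : ℝ) * (s' - s)) ≤ (K + 1) * σ ^ 2 * τ := by
  have hx3 : 0 < x ^ (1 / 3 : ℝ) := Real.rpow_pos_of_pos hx _
  have h1 : x ^ (1 / 3 : ℝ) * (s' - s) ≤ τ := by
    have h := mul_le_mul_of_nonneg_left (show s' - s ≤ τ * x ^ (-(1 / 3 : ℝ)) by linarith) hx3.le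
    rw [Real.rpow_neg hx.le] at h
    calc x ^ (1 / 3 : ℝ) * (s' - s) ≤ x ^ (1 / 3 : ℝ) * (τ * (x ^ (1 / 3 : ℝ))⁻¹) := h
      _ = τ := by field_simp
  have h2 : σ ^ 2 * x ^ (1 / 3 : ℝ) * (s' - s) ≤ σ ^ 2 * τ := by
    rw [mul_assoc]
    exact mul_le_mul_of_nonneg_left h1 (sq_nonneg σ)
  have h3 : 0 ≤ σ ^ 2 * τ := mul_nonneg (sq_nonneg σ) hτ
  nlinarith [mul_le_mul_of_nonneg_left h2 hK]

/-! ### Pathwise facts along a hard-sphere flow -/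

section Pathwise

variable {d X : Type*} [Fintype d] [MeasureSpace X] [TopologicalSpace X] {G : Geometry d X}
  {ε : ℝ} {n : ℕ}

/-- **Pathwise: the window gain is at most the energy-weighted pre-collisional flux.**  On a good
orbit every record of the collision sum is an `ofConfig` record, whose pair energy is conserved
(`HardSphereCollisionRecord.ofConfig_norm_sq_preVel`), so record by record
`(Δ₄)₊/2 ≤ ‖v₁⁻‖² ‖v₂⁻‖²` (`quarticGain_le_normSq_mul`) and the finite sums compare
(`collisionPairSum_mono`). [folklore] -/
theorem gainSum_le_energyFluxSum (Φ : HardSphereFlow G ε n) {z : Config n d X} (hz : z ∈ Φ.good)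
    (s s' : ℝ) :
    Φ.collisionSum (Ioc s s')
        (fun col => max (‖col.postVel.1‖ ^ 4 + ‖col.postVel.2‖ ^ 4
          - ‖col.preVel.1‖ ^ 4 - ‖col.preVel.2‖ ^ 4) 0 / 2) z ≤
      Φ.collisionSum (Ioc s s') (fun col => ‖col.preVel.1‖ ^ 2 * ‖col.preVel.2‖ ^ 2) z := by
  rw [HardSphereFlow.collisionSum_eq, HardSphereFlow.collisionSum_eq,
    collisionSum_eq_collisionPairSum, collisionSum_eq_collisionPairSum]
  exact collisionPairSum_mono (Φ.finite_collisionTimes_inter hz Ioc_subset_Icc_self)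
    fun t _ p _ => quarticGain_le_normSq_mul
      (HardSphereCollisionRecord.ofConfig_norm_sq_preVel G ε (Φ.flow t z) t p.1 p.2)

end Pathwise

section Torus

variable {N : ℕ} {ε : ℝ}

/-- **Second moments are conserved and dominated by the quartic datum**: on a good orbit,
`(N+1)⁻¹ ∑ᵢ ‖vᵢ(r)‖² = (N+1)⁻¹ ∑ᵢ ‖vᵢ(0)‖² ≤ 1 + (N+1)⁻¹ ∑ᵢ ‖vᵢ(0)‖⁴` (energy conservation
`IsHardSphereTrajectory.configEnergy_eq_holds` and `‖v‖² ≤ 1 + ‖v‖⁴`). [folklore] -/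
theorem normSqAvg_le_one_add_quarticAvg
    (Φ : HardSphereFlow (Torus.geometry (Fin 3)) ε (N + 1)) {z : Config (N + 1) (Fin 3) T3}
    (hz : z ∈ Φ.good) (r : ℝ) :
    ((N : ℝ) + 1)⁻¹ * ∑ i : Fin (N + 1), ‖(Φ.flow r z i).2‖ ^ 2 ≤
      1 + ((N : ℝ) + 1)⁻¹ * ∑ i : Fin (N + 1), ‖(Φ.flow 0 z i).2‖ ^ 4 := by
  have hE := IsHardSphereTrajectory.configEnergy_eq_holds (Φ.isTrajectory z hz) r 0
  simp only [configEnergy] at hE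
  have hE' : ∑ i : Fin (N + 1), ‖(Φ.flow r z i).2‖ ^ 2 = ∑ i : Fin (N + 1), ‖(Φ.flow 0 z i).2‖ ^ 2 := by
    linarith
  have hpt : ∑ i : Fin (N + 1), ‖(Φ.flow 0 z i).2‖ ^ 2 ≤
      ∑ i : Fin (N + 1), (1 + ‖(Φ.flow 0 z i).2‖ ^ 4) :=
    Finset.sum_le_sum fun i _ => sq_le_one_add_pow_four _
  rw [Finset.sum_add_distrib, Finset.sum_const, Finset.card_univ, Fintype.card_fin, nsmul_eq_mul,
    mul_one, Nat.cast_add, Nat.cast_one] at hpt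
  have hN : (0 : ℝ) < (N : ℝ) + 1 := by positivity
  rw [hE']
  calc ((N : ℝ) + 1)⁻¹ * ∑ i : Fin (N + 1), ‖(Φ.flow 0 z i).2‖ ^ 2
      ≤ ((N : ℝ) + 1)⁻¹ * (((N : ℝ) + 1) + ∑ i : Fin (N + 1), ‖(Φ.flow 0 z i).2‖ ^ 4) :=
        mul_le_mul_of_nonneg_left hpt (inv_nonneg.2 hN.le)
    _ = _ := by rw [mul_add, inv_mul_cancel₀ hN.ne']

/-- Measurability of the normalised power-sum integrand `z ↦ ofReal ((N+1)⁻¹ ∑ᵢ ‖vᵢ(r)‖ᵏ)` along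
a hard-sphere flow (each `Φ.flow r` is measurable). [folklore] -/
theorem measurable_ofReal_powSum_flow
    (Φ : HardSphereFlow (Torus.geometry (Fin 3)) ε (N + 1)) (r : ℝ) (k : ℕ) :
    Measurable fun z : Config (N + 1) (Fin 3) T3 =>
      ENNReal.ofReal (((N : ℝ) + 1)⁻¹ * ∑ i : Fin (N + 1), ‖(Φ.flow r z i).2‖ ^ k) := by
  refine ENNReal.measurable_ofReal.comp (Measurable.const_mul ?_ _)
  refine Finset.measurable_sum _ fun i _ => ?_
  exact (((measurable_pi_apply i).comp (Φ.measurable_flow r)).snd.norm).pow_const k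

/-- **Integrated second-moment bound**: under a probability law carried by the good set,
`m₂(r) ≤ 1 + m₄(0)` in `ℝ≥0∞`. [folklore] -/
theorem lintegral_normSqAvg_le
    (Φ : HardSphereFlow (Torus.geometry (Fin 3)) ε (N + 1))
    (μ : Measure (Config (N + 1) (Fin 3) T3)) [IsProbabilityMeasure μ]
    (hgood : ∀ᵐ z ∂μ, z ∈ Φ.good) (r : ℝ) :
    (∫⁻ z, ENNReal.ofReal (((N : ℝ) + 1)⁻¹ * ∑ i : Fin (N + 1), ‖(Φ.flow r z i).2‖ ^ 2) ∂μ) ≤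
      1 + ∫⁻ z, ENNReal.ofReal (((N : ℝ) + 1)⁻¹ * ∑ i : Fin (N + 1), ‖(Φ.flow 0 z i).2‖ ^ 4) ∂μ := by
  have hc : (0 : ℝ) ≤ ((N : ℝ) + 1)⁻¹ := by positivity
  calc (∫⁻ z, ENNReal.ofReal (((N : ℝ) + 1)⁻¹ * ∑ i : Fin (N + 1), ‖(Φ.flow r z i).2‖ ^ 2) ∂μ)
      ≤ ∫⁻ z, (1 + ENNReal.ofReal
          (((N : ℝ) + 1)⁻¹ * ∑ i : Fin (N + 1), ‖(Φ.flow 0 z i).2‖ ^ 4)) ∂μ := by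
        refine lintegral_mono_ae ?_
        filter_upwards [hgood] with z hz
        have h4 : 0 ≤ ((N : ℝ) + 1)⁻¹ * ∑ i : Fin (N + 1), ‖(Φ.flow 0 z i).2‖ ^ 4 :=
          mul_nonneg hc (Finset.sum_nonneg fun i _ => by positivity)
        rw [← ENNReal.ofReal_one, ← ENNReal.ofReal_add zero_le_one h4]
        exact ENNReal.ofReal_le_ofReal (normSqAvg_le_one_add_quarticAvg Φ hz r)
    _ = _ := by
        rw [lintegral_add_right _ (measurable_ofReal_powSum_flow Φ 0 4), lintegral_const,
          measure_univ, mul_one]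

/-- **Integrated AM–GM bound for the third moment**: `m₃(r) ≤ (λ/2) m₄(r) + m₂(r)/(2λ)` in `ℝ≥0∞`,
for every law `μ` and `λ > 0`. [folklore] -/
theorem lintegral_cubicAvg_le
    (Φ : HardSphereFlow (Torus.geometry (Fin 3)) ε (N + 1))
    (μ : Measure (Config (N + 1) (Fin 3) T3)) (r : ℝ) {l : ℝ} (hl : 0 < l) :
    (∫⁻ z, ENNReal.ofReal (((N : ℝ) + 1)⁻¹ * ∑ i : Fin (N + 1), ‖(Φ.flow r z i).2‖ ^ 3) ∂μ) ≤
      ENNReal.ofReal (l / 2) *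
          (∫⁻ z, ENNReal.ofReal (((N : ℝ) + 1)⁻¹ * ∑ i : Fin (N + 1), ‖(Φ.flow r z i).2‖ ^ 4) ∂μ) +
        ENNReal.ofReal (1 / (2 * l)) *
          (∫⁻ z, ENNReal.ofReal (((N : ℝ) + 1)⁻¹ * ∑ i : Fin (N + 1), ‖(Φ.flow r z i).2‖ ^ 2) ∂μ) := by
  have hc : (0 : ℝ) ≤ ((N : ℝ) + 1)⁻¹ := by positivity
  have hl2 : (0 : ℝ) ≤ l / 2 := by positivity
  have hl2' : (0 : ℝ) ≤ 1 / (2 * l) := by positivity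
  rw [← lintegral_const_mul _ (measurable_ofReal_powSum_flow Φ r 4),
    ← lintegral_const_mul _ (measurable_ofReal_powSum_flow Φ r 2),
    ← lintegral_add_left ((measurable_ofReal_powSum_flow Φ r 4).const_mul _)]
  refine lintegral_mono fun z => ?_
  have h4 : 0 ≤ ((N : ℝ) + 1)⁻¹ * ∑ i : Fin (N + 1), ‖(Φ.flow r z i).2‖ ^ 4 :=
    mul_nonneg hc (Finset.sum_nonneg fun i _ => by positivity)
  have h2 : 0 ≤ ((N : ℝ) + 1)⁻¹ * ∑ i : Fin (N + 1), ‖(Φ.flow r z i).2‖ ^ 2 :=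
    mul_nonneg hc (Finset.sum_nonneg fun i _ => by positivity)
  rw [← ENNReal.ofReal_mul hl2, ← ENNReal.ofReal_mul hl2',
    ← ENNReal.ofReal_add (mul_nonneg hl2 h4) (mul_nonneg hl2' h2)]
  exact ENNReal.ofReal_le_ofReal
    (cubicAvg_le_quartic_add_sq _ (fun i => ‖(Φ.flow r z i).2‖) hc hl)

end Torus

/-! ### Assembly in `ℝ≥0∞` -/

/-- **The arithmetic of the gain ceiling.**  If `G ≤ P · S₂ · S₃` with `P ≤ A`, `S₂ ≤ M` and
`S₃ ≤ (λ/2) Y + M/(2λ)` (`A, M ≥ 0`), then `G ≤ A M²/(2λ) + (A M λ/2) · Y` — everything in `ℝ≥0∞`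
with real (`ofReal`) coefficients, `Y` possibly `⊤`. [folklore] -/
theorem gainCeiling_assembly {G P S₂ S₃ Y : ℝ≥0∞} {A M l : ℝ} (hA : 0 ≤ A) (hM : 0 ≤ M)
    (hG : G ≤ P * S₂ * S₃) (hP : P ≤ ENNReal.ofReal A) (hS₂ : S₂ ≤ ENNReal.ofReal M)
    (hS₃ : S₃ ≤ ENNReal.ofReal (l / 2) * Y + ENNReal.ofReal (M / (2 * l))) :
    G ≤ ENNReal.ofReal (A * M * (M / (2 * l))) + ENNReal.ofReal (A * M * (l / 2)) * Y := by
  have hAM : 0 ≤ A * M := mul_nonneg hA hM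
  calc G ≤ P * S₂ * S₃ := hG
    _ ≤ ENNReal.ofReal A * ENNReal.ofReal M *
          (ENNReal.ofReal (l / 2) * Y + ENNReal.ofReal (M / (2 * l))) :=
        mul_le_mul' (mul_le_mul' hP hS₂) hS₃
    _ = ENNReal.ofReal (A * M * (M / (2 * l))) + ENNReal.ofReal (A * M * (l / 2)) * Y := by
        rw [ENNReal.ofReal_mul hAM, ENNReal.ofReal_mul hAM, ENNReal.ofReal_mul hA]
        ring

/-! ### The stub -/

/-- **Stub S2b — THE GAIN CEILING FROM THE FLUX CEILING** (glue) of the line `quartic-schur-ledger`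
(crux stmt-AtomisticToContinuum-9235, `EnergyCurrentTails`): `Q0 → S2a → S2`.  Assuming the quartic
datum bound Q0 (`m₄(0) ≤ B` for `N ≥ N₀`, local Gibbs data, `0 < σ < σ₀`) and the energy-weighted
pre-collisional flux ceiling S2a (`∫ (N+1)⁻¹ Σ_{records in (s,s′]} ‖v₁⁻‖²‖v₂⁻‖² dλ_N ≤
K σ²(N+1)^{1/3}(s′−s) · sup_{[s,s′]} m₂ · sup_{[s,s′]} m₃` on windows `s′ ≤ s + τ(N+1)^{-1/3}` in the
frame of the crux), the sub-linear window gain ceiling S2 holds: for every `η > 0` there are `D ≥ 0`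
and `N₀` with `Gain(s,s′] ≤ D + η · sup_{r ∈ [s,s′]} m₄(r)`.  Pathwise `(Δ₄)₊/2 ≤ ‖v₁⁻‖²‖v₂⁻‖²`
(pair energy conservation, `gainSum_le_energyFluxSum`); `m₂(r) ≤ 1 + B` (energy conservation,
`lintegral_normSqAvg_le`); `m₃ ≤ (λ/2) m₄ + m₂/(2λ)` (`lintegral_cubicAvg_le`); the clock cancels
(`clockFactor_le`); and with `M = 1 + B`, `K′ = K + 1`, `λ = 2η/(K′σ²τM)`:
`D = (K′σ²τ)² M³/(4η)` (`gainCeiling_assembly`). [folklore] -/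
theorem stub_gainCeiling_of_energyFluxCeiling :
     (∀ (a₀ θ₀ : T3 → ℝ) (u₀ : T3 → V3), Continuous a₀ → Continuous θ₀ → Continuous u₀ →
        (∀ x, 0 < a₀ x) → (∀ x, 0 < θ₀ x) →
        ∃ σ₀ : ℝ, 0 < σ₀ ∧ ∀ σ : ℝ, 0 < σ → σ < σ₀ →
          ∀ Φ : (N : ℕ) → HardSphereFlow (Torus.geometry (Fin 3)) (hsDiameter σ N) (N + 1),
            ∃ B : ℝ, 0 ≤ B ∧ ∃ N₀ : ℕ, ∀ N : ℕ, N₀ ≤ N →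
              (∫⁻ z, ENNReal.ofReal (((N : ℝ) + 1)⁻¹ *
                  ∑ i : Fin (N + 1), ‖((Φ N).flow 0 z i).2‖ ^ 4)
                ∂(localGibbsLaw σ a₀ u₀ θ₀ N (Φ N))) ≤ ENNReal.ofReal B ∧
              ∃ B' : ℝ, ∀ r : ℝ,
                (∫⁻ z, ENNReal.ofReal (((N : ℝ) + 1)⁻¹ *
                    ∑ i : Fin (N + 1), ‖((Φ N).flow r z i).2‖ ^ 4)
                  ∂(localGibbsLaw σ a₀ u₀ θ₀ N (Φ N))) ≤ ENNReal.ofReal B') →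
     (∀ (a₀ θ₀ : T3 → ℝ) (u₀ : T3 → V3), Continuous a₀ → Continuous θ₀ → Continuous u₀ →
        (∀ x, 0 < a₀ x) → (∀ x, 0 < θ₀ x) →
        ∃ σ₀ : ℝ, 0 < σ₀ ∧ ∀ σ : ℝ, 0 < σ → σ < σ₀ →
          ∀ (T : ℝ) (ρ θ : ℝ → T3 → ℝ) (u : ℝ → T3 → V3), IsHardSphereEulerSolution σ T ρ u θ →
            ∀ Φ : (N : ℕ) → HardSphereFlow (Torus.geometry (Fin 3)) (hsDiameter σ N) (N + 1),
              TendstoHydroFieldsAt (fun N => localGibbsLaw σ a₀ u₀ θ₀ N (Φ N)) Φ ρ u θ 0 →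
                ∀ t ∈ Set.Ico 0 T, ∀ τ : ℝ, 0 < τ → ∃ K : ℝ, 0 ≤ K ∧
                  ∃ N₀ : ℕ, ∀ N : ℕ, N₀ ≤ N → ∀ s ∈ Set.Icc 0 t,
                    ∀ s' ∈ Set.Icc s (s + τ * ((N : ℝ) + 1) ^ (-(1 / 3 : ℝ))),
                      (∫⁻ z, ENNReal.ofReal (((N : ℝ) + 1)⁻¹ *
                          (Φ N).collisionSum (Set.Ioc s s')
                            (fun col => ‖col.preVel.1‖ ^ 2 * ‖col.preVel.2‖ ^ 2) z)
                        ∂(localGibbsLaw σ a₀ u₀ θ₀ N (Φ N)))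
                      ≤ ENNReal.ofReal (K * (σ ^ 2 * ((N : ℝ) + 1) ^ (1 / 3 : ℝ) * (s' - s))) *
                          (⨆ r ∈ Set.Icc s s',
                            (∫⁻ z, ENNReal.ofReal (((N : ℝ) + 1)⁻¹ *
                                ∑ i : Fin (N + 1), ‖((Φ N).flow r z i).2‖ ^ 2)
                              ∂(localGibbsLaw σ a₀ u₀ θ₀ N (Φ N)))) *
                          (⨆ r ∈ Set.Icc s s',
                            (∫⁻ z, ENNReal.ofReal (((N : ℝ) + 1)⁻¹ *
                                ∑ i : Fin (N + 1), ‖((Φ N).flow r z i).2‖ ^ 3)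
                              ∂(localGibbsLaw σ a₀ u₀ θ₀ N (Φ N))))) →
     (∀ (a₀ θ₀ : T3 → ℝ) (u₀ : T3 → V3), Continuous a₀ → Continuous θ₀ → Continuous u₀ →
        (∀ x, 0 < a₀ x) → (∀ x, 0 < θ₀ x) →
        ∃ σ₀ : ℝ, 0 < σ₀ ∧ ∀ σ : ℝ, 0 < σ → σ < σ₀ →
          ∀ (T : ℝ) (ρ θ : ℝ → T3 → ℝ) (u : ℝ → T3 → V3), IsHardSphereEulerSolution σ T ρ u θ →
            ∀ Φ : (N : ℕ) → HardSphereFlow (Torus.geometry (Fin 3)) (hsDiameter σ N) (N + 1),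
              TendstoHydroFieldsAt (fun N => localGibbsLaw σ a₀ u₀ θ₀ N (Φ N)) Φ ρ u θ 0 →
                ∀ t ∈ Set.Ico 0 T, ∀ τ : ℝ, 0 < τ → ∀ η : ℝ, 0 < η → ∃ D : ℝ, 0 ≤ D ∧
                  ∃ N₀ : ℕ, ∀ N : ℕ, N₀ ≤ N → ∀ s ∈ Set.Icc 0 t,
                    ∀ s' ∈ Set.Icc s (s + τ * ((N : ℝ) + 1) ^ (-(1 / 3 : ℝ))),
                      (∫⁻ z, ENNReal.ofReal (((N : ℝ) + 1)⁻¹ *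
                          (Φ N).collisionSum (Set.Ioc s s')
                            (fun col => max (‖col.postVel.1‖ ^ 4 + ‖col.postVel.2‖ ^ 4
                              - ‖col.preVel.1‖ ^ 4 - ‖col.preVel.2‖ ^ 4) 0 / 2) z)
                        ∂(localGibbsLaw σ a₀ u₀ θ₀ N (Φ N)))
                      ≤ ENNReal.ofReal D + ENNReal.ofReal η *
                          ⨆ r ∈ Set.Icc s s',
                            (∫⁻ z, ENNReal.ofReal (((N : ℝ) + 1)⁻¹ *
                                ∑ i : Fin (N + 1), ‖((Φ N).flow r z i).2‖ ^ 4)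
                              ∂(localGibbsLaw σ a₀ u₀ θ₀ N (Φ N)))) := by
  intro hQ hF a₀ θ₀ u₀ ha hθ hu ha0 hθ0
  obtain ⟨σ₁, hσ₁, H1⟩ := hQ a₀ θ₀ u₀ ha hθ hu ha0 hθ0
  obtain ⟨σ₂, hσ₂, H2⟩ := hF a₀ θ₀ u₀ ha hθ hu ha0 hθ0
  refine ⟨min (min σ₁ σ₂) (1 / 2), by positivity, ?_⟩
  intro σ hσ hσ0 T ρ θ u hE Φ h0 t ht τ hτ η hη
  have hσ₁' : σ < σ₁ := hσ0.trans_le ((min_le_left _ _).trans (min_le_left _ _))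
  have hσ₂' : σ < σ₂ := hσ0.trans_le ((min_le_left _ _).trans (min_le_right _ _))
  have hσh : σ ≤ 1 / 2 := (hσ0.trans_le (min_le_right _ _)).le
  obtain ⟨B, hB, N₁, HQ⟩ := H1 σ hσ hσ₁' Φ
  obtain ⟨K, hK, N₂, HF⟩ := H2 σ hσ hσ₂' T ρ θ u hE Φ h0 t ht τ hτ
  -- the constants
  set A : ℝ := (K + 1) * σ ^ 2 * τ with hA_def
  set M : ℝ := 1 + B with hM_def
  have hA : 0 < A := by positivity
  have hM : 0 < M := by positivity
  set l : ℝ := 2 * η / (A * M) with hl_def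
  have hl : 0 < l := by positivity
  have hslope : A * M * (l / 2) = η := by
    rw [hl_def]
    field_simp
  refine ⟨A * M * (M / (2 * l)), by positivity, max N₁ N₂, ?_⟩
  intro N hN s hs s' hs'
  obtain ⟨hQ4, -⟩ := HQ N ((le_max_left _ _).trans hN)
  have hflux := HF N ((le_max_right _ _).trans hN) s hs s' hs'
  haveI := isProbabilityMeasure_localGibbsLaw ha hθ hu ha0 hθ0 hσh N (Φ N)
  have hgood := ae_mem_good_localGibbsLaw σ a₀ u₀ θ₀ N (Φ N)
  have hN1 : (0 : ℝ) < (N : ℝ) + 1 := by positivity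
  have hc : (0 : ℝ) ≤ ((N : ℝ) + 1)⁻¹ := inv_nonneg.2 hN1.le
  -- (2) the second moments: `m₂(r) ≤ ofReal M`
  have hM2 : ∀ r : ℝ, (∫⁻ z, ENNReal.ofReal (((N : ℝ) + 1)⁻¹ *
      ∑ i : Fin (N + 1), ‖((Φ N).flow r z i).2‖ ^ 2) ∂(localGibbsLaw σ a₀ u₀ θ₀ N (Φ N))) ≤
        ENNReal.ofReal M := fun r => by
    rw [hM_def, ENNReal.ofReal_add zero_le_one hB, ENNReal.ofReal_one]
    exact (lintegral_normSqAvg_le (Φ N) _ hgood r).trans (add_le_add le_rfl hQ4)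
  have hS2 : (⨆ r ∈ Set.Icc s s', (∫⁻ z, ENNReal.ofReal (((N : ℝ) + 1)⁻¹ *
      ∑ i : Fin (N + 1), ‖((Φ N).flow r z i).2‖ ^ 2) ∂(localGibbsLaw σ a₀ u₀ θ₀ N (Φ N)))) ≤
        ENNReal.ofReal M :=
    iSup₂_le fun r _ => hM2 r
  -- (3) the third moments: `m₃(r) ≤ (λ/2) Y + M/(2λ)`
  have hS3 : (⨆ r ∈ Set.Icc s s', (∫⁻ z, ENNReal.ofReal (((N : ℝ) + 1)⁻¹ *
      ∑ i : Fin (N + 1), ‖((Φ N).flow r z i).2‖ ^ 3) ∂(localGibbsLaw σ a₀ u₀ θ₀ N (Φ N)))) ≤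
        ENNReal.ofReal (l / 2) * (⨆ r ∈ Set.Icc s s', (∫⁻ z, ENNReal.ofReal (((N : ℝ) + 1)⁻¹ *
          ∑ i : Fin (N + 1), ‖((Φ N).flow r z i).2‖ ^ 4) ∂(localGibbsLaw σ a₀ u₀ θ₀ N (Φ N)))) +
        ENNReal.ofReal (M / (2 * l)) := by
    refine iSup₂_le fun r hr => (lintegral_cubicAvg_le (Φ N) _ r hl).trans ?_
    refine add_le_add (mul_le_mul' le_rfl ?_) ?_
    · exact le_iSup₂ (f := fun r (_ : r ∈ Set.Icc s s') => ∫⁻ z, ENNReal.ofReal (((N : ℝ) + 1)⁻¹ *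
          ∑ i : Fin (N + 1), ‖((Φ N).flow r z i).2‖ ^ 4) ∂(localGibbsLaw σ a₀ u₀ θ₀ N (Φ N))) r hr
    · calc ENNReal.ofReal (1 / (2 * l)) * (∫⁻ z, ENNReal.ofReal (((N : ℝ) + 1)⁻¹ *
            ∑ i : Fin (N + 1), ‖((Φ N).flow r z i).2‖ ^ 2) ∂(localGibbsLaw σ a₀ u₀ θ₀ N (Φ N)))
          ≤ ENNReal.ofReal (1 / (2 * l)) * ENNReal.ofReal M := mul_le_mul' le_rfl (hM2 r)
        _ = ENNReal.ofReal (M / (2 * l)) := by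
          rw [← ENNReal.ofReal_mul (by positivity)]
          congr 1
          field_simp
  -- (4) the clock cancels
  have hP : ENNReal.ofReal (K * (σ ^ 2 * ((N : ℝ) + 1) ^ (1 / 3 : ℝ) * (s' - s))) ≤
      ENNReal.ofReal A :=
    ENNReal.ofReal_le_ofReal (clockFactor_le hK hτ.le hN1 hs'.2)
  -- (1) gain ≤ flux, pathwise on the good set
  have hG : (∫⁻ z, ENNReal.ofReal (((N : ℝ) + 1)⁻¹ *
      (Φ N).collisionSum (Set.Ioc s s')
        (fun col => max (‖col.postVel.1‖ ^ 4 + ‖col.postVel.2‖ ^ 4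
          - ‖col.preVel.1‖ ^ 4 - ‖col.preVel.2‖ ^ 4) 0 / 2) z)
      ∂(localGibbsLaw σ a₀ u₀ θ₀ N (Φ N))) ≤
      (∫⁻ z, ENNReal.ofReal (((N : ℝ) + 1)⁻¹ *
        (Φ N).collisionSum (Set.Ioc s s')
          (fun col => ‖col.preVel.1‖ ^ 2 * ‖col.preVel.2‖ ^ 2) z)
      ∂(localGibbsLaw σ a₀ u₀ θ₀ N (Φ N))) := by
    refine lintegral_mono_ae ?_
    filter_upwards [hgood] with z hz
    exact ENNReal.ofReal_le_ofReal
      (mul_le_mul_of_nonneg_left (gainSum_le_energyFluxSum (Φ N) hz s s') hc)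
  -- (5) assemble
  have hfin := gainCeiling_assembly hA.le hM.le (hG.trans hflux) hP hS2 hS3
  rwa [hslope] at hfin

end Summit.AtomisticToContinuum.HydrodynamicLimit.Theorems.QuarticSchurLedger

end
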